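import Summits.ValiantsHypothesis.ValiantsHypothesis.Theorems.LacunarySymmetroidMatrixDescartesDeepEndLawBothKit
import Summits.ValiantsHypothesis.ValiantsHypothesis.Theorems.LacunarySymmetroidMatrixDescartesTailGraftBottom

/-!
# `MatrixDescartes` census — TWO DEEP ENDS at `m = 2`: `ζ_sym(2, K+2) ≥ N + M_top + M_bot + 4` from a core certificate and two compressions

HONEST FRAMING.  Cell `val-V1-extremal` (engine seat val-v1x-eng-6 g4), crux `Theses.LacunarySymmetroid.MatrixDescartes`
(stmt-ValiantsHypothesis-18050).  LOWER-bound / construction mathematics in census (CONJECTURE-A) currency at `m = 2` (outside the crux window);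
nothing here bears on the crux, on `DoorA26` / `DoorA34`, or on `VP ≠ VNP`.  No definitions.  Helper mode.

THE LAW (`exists_alternating_twoDeepEnds`, row form `not_posRootLawAt_twoDeepEnds`).  Core: a `K`-letter real symmetric `2 × 2` pencil `P` with an
`N`-alternation certificate `τ`.  Top datum: `v` and an `M_t`-alternation certificate `σ` of the compression `v ⬝ᵥ adj(P) v = (Jv)ᵀ P (Jv)` ABOVE `τ`.
Bottom datum: `v'` and an `M_b`-alternation certificate `ρ` of `v' ⬝ᵥ adj(P) v'` BELOW `τ`.  Then the `(K+2)`-letter pencil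
`μ_b v'v'ᵀ + y^D P(y) + μ_t y^(n₀+2D) v vᵀ` (`n₀` above every `d l`) alternates, for `D` large and suitable `μ_b, μ_t ≠ 0`, along ALL of
`ρ < τ < σ`: `N + M_t + M_b + 2` alternations; both end letters are rank one, so the tree's two-ended TAIL GRAFT
(`TailGraft.not_posRootLawAt_of_tail_both`) adds two more: **`¬ PosRootLawAt 2 (K+2) (N + M_t + M_b + 3)`** — the census bookkeeping
«record = core + (2 + γ_top) + (2 + γ_bot)» of the `m = 2` rows (`C22 = 13 + 5 + 4`, `GRAFT25 = 16 + 5 + 4`) as ONE theorem with `γ = M` the far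
alternations of the two compressions.  Mechanism: for `2 × 2` letters `det(A + p v'v'ᵀ + q v vᵀ) = det A + p·u'(A) + q·u(A) + p q (v × v')²`
(`det_add_two_rankOne`); with `μ_b = ε_b t_b^D`, `μ_t = ε_t / t_s^(n₀+D)` (`ρ_last < t_b < τ_0`, `τ_N < t_s < σ_0`) every non-leading term dies at
every test point as `D → ∞` (the cross term through `(t_b/t_s)^D`), and the two junction signs are free.  [folklore] throughout.
-/

-- `Summit.ValiantsHypothesis.ValiantsHypothesis.…` repeats a component by the D-0017 layout
-- (single-conjunct summit), which the `dupNamespace` linter flags; the name is mandated.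
set_option linter.dupNamespace false

namespace Summit.ValiantsHypothesis.ValiantsHypothesis.Theorems.LacunarySymmetroidMatrixDescartes.Census.DeepEnd

open Matrix Finset Filter Topology
open scoped BigOperators
open Summit.ValiantsHypothesis.ValiantsHypothesis.Theorems.LacunarySymmetroidMatrixDescartes.Census.Graft
open Summit.ValiantsHypothesis.ValiantsHypothesis.Theorems.LacunarySymmetroidMatrixDescartes.TailGraft
open Summit.ValiantsHypothesis.ValiantsHypothesis.Theorems.MatrixDescartes.Negative (PosRootLawAt)

/-! ### The two-ended law -/

/-- **TWO DEEP ENDS (m = 2).**  See the module docstring: core certificate `τ` (`N` alternations), top compression certificate `σ` above it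
(`M_t` alternations), bottom compression certificate `ρ` below it (`M_b`), both compressions nonvanishing at their points ⇒ a `(K+2)`-letter real
symmetric pencil with RANK-ONE end letters (`μ_b v'v'ᵀ` at exponent `0`, `μ_t v vᵀ` on top, core shifted by `D`) alternating along the glued
`M_b + N + M_t + 3` points. [folklore] -/
theorem exists_alternating_twoDeepEnds {K N Mt Mb : ℕ} (d : Fin K → ℕ) (S : Fin K → Matrix (Fin 2) (Fin 2) ℝ)
    (τ : Fin (N + 1) → ℝ) (hτ : StrictMono τ) (hτpos : ∀ j, 0 < τ j)
    (hne : ∀ j, (∑ l, τ j ^ d l • S l).det ≠ 0)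
    (halt : ∀ j : Fin N, (∑ l, τ j.castSucc ^ d l • S l).det * (∑ l, τ j.succ ^ d l • S l).det < 0)
    (v : Fin 2 → ℝ) (σ : Fin (Mt + 1) → ℝ) (hσ : StrictMono σ) (hsep : τ (Fin.last N) < σ 0)
    (hune : ∀ j, v ⬝ᵥ ((∑ l, σ j ^ d l • S l).adjugate *ᵥ v) ≠ 0)
    (hualt : ∀ j : Fin Mt, (v ⬝ᵥ ((∑ l, σ j.castSucc ^ d l • S l).adjugate *ᵥ v)) *
      (v ⬝ᵥ ((∑ l, σ j.succ ^ d l • S l).adjugate *ᵥ v)) < 0)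
    (v' : Fin 2 → ℝ) (ρ : Fin (Mb + 1) → ℝ) (hρ : StrictMono ρ) (hρpos : ∀ j, 0 < ρ j) (hsep' : ρ (Fin.last Mb) < τ 0)
    (hune' : ∀ j, v' ⬝ᵥ ((∑ l, ρ j ^ d l • S l).adjugate *ᵥ v') ≠ 0)
    (hualt' : ∀ j : Fin Mb, (v' ⬝ᵥ ((∑ l, ρ j.castSucc ^ d l • S l).adjugate *ᵥ v')) *
      (v' ⬝ᵥ ((∑ l, ρ j.succ ^ d l • S l).adjugate *ᵥ v')) < 0) :
    ∃ (D : ℕ) (μb μt : ℝ), 0 < D ∧ (∀ l, d l < (∑ i, d i) + 1 + D) ∧ μb ≠ 0 ∧ μt ≠ 0 ∧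
      let e : Fin (K + 1 + 1) → ℕ :=
        Fin.cons 0 (Fin.snoc (fun l => d l + D) ((∑ i, d i) + 1 + 2 * D) : Fin (K + 1) → ℕ)
      let T : Fin (K + 1 + 1) → Matrix (Fin 2) (Fin 2) ℝ :=
        Fin.cons (μb • vecMulVec v' v') (Fin.snoc S (μt • vecMulVec v v) : Fin (K + 1) → Matrix (Fin 2) (Fin 2) ℝ)
      let τ' : Fin (Mb + N + Mt + 3) → ℝ := fun j =>
        if h : (j : ℕ) ≤ Mb then ρ ⟨j, Nat.lt_succ_of_le h⟩
        else if h' : (j : ℕ) ≤ Mb + N + 1 then τ ⟨(j : ℕ) - (Mb + 1), by omega⟩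
        else σ ⟨(j : ℕ) - (Mb + N + 2), by omega⟩
      StrictMono τ' ∧ (∀ j, 0 < τ' j) ∧ (∀ j, (∑ l, τ' j ^ e l • T l).det ≠ 0) ∧
      ∀ j : Fin (Mb + N + Mt + 2), (∑ l, τ' j.castSucc ^ e l • T l).det * (∑ l, τ' j.succ ^ e l • T l).det < 0 := by
  classical
  set P : ℝ → Matrix (Fin 2) (Fin 2) ℝ := fun y => ∑ l, y ^ d l • S l with hP
  set u : ℝ → ℝ := fun y => v ⬝ᵥ ((P y).adjugate *ᵥ v) with hu
  set u' : ℝ → ℝ := fun y => v' ⬝ᵥ ((P y).adjugate *ᵥ v') with hu'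
  set n₀ : ℕ := (∑ i, d i) + 1 with hn₀
  have hdn₀ : ∀ l, d l < n₀ := by
    intro l
    have : d l ≤ ∑ i, d i := Finset.single_le_sum (fun i _ => Nat.zero_le (d i)) (Finset.mem_univ l)
    omega
  set c₀ : ℝ := (v 0 * v' 1 - v 1 * v' 0) ^ 2 with hc₀
  have hσpos : ∀ j, 0 < σ j := fun j =>
    lt_of_lt_of_le ((hτpos _).trans hsep) (hσ.monotone (Fin.zero_le j))
  -- separators
  obtain ⟨ts, hts1, hts2⟩ : ∃ t : ℝ, τ (Fin.last N) < t ∧ t < σ 0 := exists_between hsep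
  obtain ⟨tb, htb1, htb2⟩ : ∃ t : ℝ, ρ (Fin.last Mb) < t ∧ t < τ 0 := exists_between hsep'
  have htspos : 0 < ts := (hτpos _).trans hts1
  have htbpos : 0 < tb := (hρpos _).trans htb1
  have htbts : tb < ts := htb2.trans ((hτ.monotone (Fin.zero_le _)).trans_lt hts1)
  -- junction signs
  set εt : ℝ := -((P (τ (Fin.last N))).det * u (σ 0)) with hεt
  set εb : ℝ := -((P (τ 0)).det * u' (ρ (Fin.last Mb))) with hεb
  have hεtne : εt ≠ 0 := by rw [hεt]; exact neg_ne_zero.mpr (mul_ne_zero (hne _) (hune 0))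
  have hεbne : εb ≠ 0 := by rw [hεb]; exact neg_ne_zero.mpr (mul_ne_zero (hne _) (hune' _))
  -- the determinant of the two-ended pencil, divided by y^{2D}: g D y
  -- pencil value: μb v'v'ᵀ + y^D P y + μt y^{n₀+2D} v vᵀ, μb = εb tb^D, μt = εt / ts^{n₀+D}
  have hdet : ∀ (D : ℕ) (y : ℝ), 0 < y →
      ((εb * tb ^ D) • vecMulVec v' v' + y ^ D • P y + (y ^ (n₀ + 2 * D) * (εt * (ts ^ (n₀ + D))⁻¹)) • vecMulVec v v).det
        = (y ^ D) ^ 2 * ((P y).det + εb * (tb / y) ^ D * u' y + εt * (y / ts) ^ (n₀ + D) * u y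
            + εb * εt * c₀ * ((y / ts) ^ n₀ * (tb / ts) ^ D)) := fun D y hy => by
    rw [hu, hu', hc₀]; exact det_twoEnds_scaled (P y) v v' εb εt tb ts y n₀ D hy htspos
  -- the normalised determinant and its three limits
  set g : ℕ → ℝ → ℝ := fun D y => (P y).det + εb * (tb / y) ^ D * u' y + εt * (y / ts) ^ (n₀ + D) * u y
      + εb * εt * c₀ * ((y / ts) ^ n₀ * (tb / ts) ^ D) with hg
  have hcross : ∀ y : ℝ, Tendsto (fun D : ℕ => εb * εt * c₀ * ((y / ts) ^ n₀ * (tb / ts) ^ D)) atTop (𝓝 0) := by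
    intro y
    have hr0 : 0 ≤ tb / ts := div_nonneg htbpos.le htspos.le
    have hr1 : tb / ts < 1 := (div_lt_one htspos).mpr htbts
    have h := ((tendsto_pow_atTop_nhds_zero_of_lt_one hr0 hr1).const_mul ((y / ts) ^ n₀)).const_mul (εb * εt * c₀)
    simpa using h
  -- (i) CORE points: everything but det P dies
  have hcore : ∀ j : Fin (N + 1), ∀ᶠ D : ℕ in atTop, 0 < g D (τ j) * (P (τ j)).det := by
    intro j
    have hb0 : 0 ≤ tb / τ j := div_nonneg htbpos.le (hτpos j).le
    have hb1 : tb / τ j < 1 := (div_lt_one (hτpos j)).mpr (htb2.trans_le (hτ.monotone (Fin.zero_le j)))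
    have ht0 : 0 ≤ τ j / ts := div_nonneg (hτpos j).le htspos.le
    have ht1 : τ j / ts < 1 := (div_lt_one htspos).mpr ((hτ.monotone (Fin.le_last j)).trans_lt hts1)
    have h1 : Tendsto (fun D : ℕ => εb * (tb / τ j) ^ D * u' (τ j)) atTop (𝓝 0) := by
      have h := ((tendsto_pow_atTop_nhds_zero_of_lt_one hb0 hb1).const_mul εb).mul_const (u' (τ j))
      simpa using h
    have h2 : Tendsto (fun D : ℕ => εt * (τ j / ts) ^ (n₀ + D) * u (τ j)) atTop (𝓝 0) := by
      have h0 : Tendsto (fun D : ℕ => (τ j / ts) ^ (n₀ + D)) atTop (𝓝 0) := by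
        have h := (tendsto_pow_atTop_nhds_zero_of_lt_one ht0 ht1).const_mul ((τ j / ts) ^ n₀)
        rw [mul_zero] at h
        refine h.congr fun D => ?_
        exact (pow_add _ _ _).symm
      have h := (h0.const_mul εt).mul_const (u (τ j))
      simpa using h
    have hlim : Tendsto (fun D : ℕ => g D (τ j)) atTop (𝓝 ((P (τ j)).det)) := by
      have h := ((tendsto_const_nhds (x := (P (τ j)).det)).add h1).add h2 |>.add (hcross (τ j))
      simp only [add_zero] at h
      exact h
    exact eventually_mul_pos_of_tendsto hlim (hne j)
  -- (ii) TOP points: divide by (σ j / ts)^(n₀+D)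
  have htop : ∀ j : Fin (Mt + 1), ∀ᶠ D : ℕ in atTop, 0 < g D (σ j) * (εt * u (σ j)) := by
    intro j
    have hq : ∀ D : ℕ, 0 < (σ j / ts) ^ (n₀ + D) := fun D => pow_pos (div_pos (hσpos j) htspos) _
    -- g = (σ/ts)^(n₀+D) * h, h → εt u(σ j)
    set h : ℕ → ℝ := fun D => (P (σ j)).det * (ts / σ j) ^ (n₀ + D)
        + εb * ((tb / σ j) ^ D * (ts / σ j) ^ (n₀ + D)) * u' (σ j) + εt * u (σ j)
        + εb * εt * c₀ * ((ts / σ j) ^ D * (tb / ts) ^ D) with hh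
    have hr0 : 0 ≤ ts / σ j := div_nonneg htspos.le (hσpos j).le
    have hr1 : ts / σ j < 1 := (div_lt_one (hσpos j)).mpr (hts2.trans_le (hσ.monotone (Fin.zero_le j)))
    have hpow1 : Tendsto (fun D : ℕ => (ts / σ j) ^ (n₀ + D)) atTop (𝓝 0) := by
      have h := (tendsto_pow_atTop_nhds_zero_of_lt_one hr0 hr1).const_mul ((ts / σ j) ^ n₀)
      rw [mul_zero] at h
      refine h.congr fun D => ?_
      exact (pow_add _ _ _).symm
    have hb0 : 0 ≤ tb / σ j := div_nonneg htbpos.le (hσpos j).le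
    have hb1 : tb / σ j < 1 := (div_lt_one (hσpos j)).mpr (htbts.trans (hts2.trans_le (hσ.monotone (Fin.zero_le j))))
    have hpow2 : Tendsto (fun D : ℕ => (tb / σ j) ^ D * (ts / σ j) ^ (n₀ + D)) atTop (𝓝 0) := by
      have h := (tendsto_pow_atTop_nhds_zero_of_lt_one hb0 hb1).mul hpow1
      simpa using h
    have hc0 : 0 ≤ tb / ts := div_nonneg htbpos.le htspos.le
    have hc1 : tb / ts < 1 := (div_lt_one htspos).mpr htbts
    have hpow3 : Tendsto (fun D : ℕ => (ts / σ j) ^ D * (tb / ts) ^ D) atTop (𝓝 0) := by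
      have h := (tendsto_pow_atTop_nhds_zero_of_lt_one hr0 hr1).mul (tendsto_pow_atTop_nhds_zero_of_lt_one hc0 hc1)
      simpa using h
    have hlim : Tendsto h atTop (𝓝 (εt * u (σ j))) := by
      have h' := ((((hpow1.const_mul ((P (σ j)).det)).add ((hpow2.const_mul εb).mul_const (u' (σ j)))).add
        (tendsto_const_nhds (x := εt * u (σ j)))).add (hpow3.const_mul (εb * εt * c₀)))
      simp only [mul_zero, zero_mul, zero_add, add_zero] at h'
      exact h'
    have hL : εt * u (σ j) ≠ 0 := mul_ne_zero hεtne (hune j)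
    have hev := eventually_mul_pos_of_tendsto hlim hL
    refine hev.mono fun D hD => ?_
    have hident : g D (σ j) = (σ j / ts) ^ (n₀ + D) * h D := by
      have hσ0 : σ j ≠ 0 := (hσpos j).ne'
      have hts0 : ts ≠ 0 := htspos.ne'
      have hXX' : (σ j / ts) ^ n₀ * (ts / σ j) ^ n₀ = 1 := by
        rw [← mul_pow, div_mul_div_comm, mul_comm (σ j) ts, div_self (mul_ne_zero hts0 hσ0), one_pow]
      have hYY' : (σ j / ts) ^ D * (ts / σ j) ^ D = 1 := by
        rw [← mul_pow, div_mul_div_comm, mul_comm (σ j) ts, div_self (mul_ne_zero hts0 hσ0), one_pow]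
      rw [hg, hh]
      simp only
      rw [pow_add (σ j / ts) n₀ D, pow_add (ts / σ j) n₀ D]
      linear_combination (-((P (σ j)).det + εb * (tb / σ j) ^ D * u' (σ j))) * hXX'
        + (-(((P (σ j)).det + εb * (tb / σ j) ^ D * u' (σ j)) * ((σ j / ts) ^ n₀ * (ts / σ j) ^ n₀)
            + εb * εt * c₀ * (σ j / ts) ^ n₀ * (tb / ts) ^ D)) * hYY'
    rw [hident, mul_assoc]
    exact mul_pos (hq D) hD
  -- (iii) BOTTOM points: divide by (tb / ρ j)^D
  have hbot : ∀ j : Fin (Mb + 1), ∀ᶠ D : ℕ in atTop, 0 < g D (ρ j) * (εb * u' (ρ j)) := by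
    intro j
    have hq : ∀ D : ℕ, 0 < (tb / ρ j) ^ D := fun D => pow_pos (div_pos htbpos (hρpos j)) _
    set h : ℕ → ℝ := fun D => (P (ρ j)).det * (ρ j / tb) ^ D + εb * u' (ρ j)
        + εt * ((ρ j / ts) ^ n₀ * ((ρ j / ts) * (ρ j / tb)) ^ D) * u (ρ j)
        + εb * εt * c₀ * ((ρ j / ts) ^ n₀ * (ρ j / ts) ^ D) with hh
    have hρtb : ρ j < tb := (hρ.monotone (Fin.le_last j)).trans_lt htb1
    have hρts : ρ j < ts := hρtb.trans htbts
    have hr0 : 0 ≤ ρ j / tb := div_nonneg (hρpos j).le htbpos.le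
    have hr1 : ρ j / tb < 1 := (div_lt_one htbpos).mpr hρtb
    have hs0 : 0 ≤ ρ j / ts := div_nonneg (hρpos j).le htspos.le
    have hs1 : ρ j / ts < 1 := (div_lt_one htspos).mpr hρts
    have hm0 : 0 ≤ (ρ j / ts) * (ρ j / tb) := mul_nonneg hs0 hr0
    have hm1 : (ρ j / ts) * (ρ j / tb) < 1 := by nlinarith
    have hpow1 : Tendsto (fun D : ℕ => (ρ j / tb) ^ D) atTop (𝓝 0) := tendsto_pow_atTop_nhds_zero_of_lt_one hr0 hr1
    have hpow2 : Tendsto (fun D : ℕ => (ρ j / ts) ^ n₀ * ((ρ j / ts) * (ρ j / tb)) ^ D) atTop (𝓝 0) := by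
      have h := (tendsto_pow_atTop_nhds_zero_of_lt_one hm0 hm1).const_mul ((ρ j / ts) ^ n₀)
      simpa using h
    have hpow3 : Tendsto (fun D : ℕ => (ρ j / ts) ^ n₀ * (ρ j / ts) ^ D) atTop (𝓝 0) := by
      have h := (tendsto_pow_atTop_nhds_zero_of_lt_one hs0 hs1).const_mul ((ρ j / ts) ^ n₀)
      simpa using h
    have hlim : Tendsto h atTop (𝓝 (εb * u' (ρ j))) := by
      have h' := ((((hpow1.const_mul ((P (ρ j)).det)).add (tendsto_const_nhds (x := εb * u' (ρ j)))).add
        ((hpow2.const_mul εt).mul_const (u (ρ j)))).add (hpow3.const_mul (εb * εt * c₀)))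
      simp only [mul_zero, zero_mul, add_zero, zero_add] at h'
      exact h'
    have hL : εb * u' (ρ j) ≠ 0 := mul_ne_zero hεbne (hune' j)
    have hev := eventually_mul_pos_of_tendsto hlim hL
    refine hev.mono fun D hD => ?_
    have hident : g D (ρ j) = (tb / ρ j) ^ D * h D := by
      have hρ0 : ρ j ≠ 0 := (hρpos j).ne'
      have hts0 : ts ≠ 0 := htspos.ne'
      have htb0 : tb ≠ 0 := htbpos.ne'
      have hWW' : (tb / ρ j) ^ D * (ρ j / tb) ^ D = 1 := by
        rw [← mul_pow, div_mul_div_comm, mul_comm tb (ρ j), div_self (mul_ne_zero hρ0 htb0), one_pow]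
      have hsplit : (tb / ts) ^ D = (tb / ρ j) ^ D * (ρ j / ts) ^ D := by
        rw [← mul_pow]; congr 1; field_simp
      rw [hg, hh]
      simp only
      rw [pow_add (ρ j / ts) n₀ D, mul_pow, hsplit]
      linear_combination (-((P (ρ j)).det + εt * ((ρ j / ts) ^ n₀ * (ρ j / ts) ^ D) * u (ρ j))) * hWW'
    rw [hident, mul_assoc]
    exact mul_pos (hq D) hD
  -- one D
  have hDpos : ∀ᶠ D : ℕ in atTop, 0 < D := eventually_gt_atTop 0
  obtain ⟨D, ⟨⟨hDcore, hDtop⟩, hDbot⟩, hD0⟩ :=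
    ((((eventually_all.mpr hcore).and (eventually_all.mpr htop)).and (eventually_all.mpr hbot)).and hDpos).exists
  refine ⟨D, εb * tb ^ D, εt * (ts ^ (n₀ + D))⁻¹, hD0, fun l => by have := hdn₀ l; omega,
    mul_ne_zero hεbne (pow_ne_zero _ htbpos.ne'),
    mul_ne_zero hεtne (inv_ne_zero (pow_ne_zero _ htspos.ne')), ?_⟩
  intro e T τ'
  -- evaluation of the pencil
  have heval : ∀ y : ℝ, 0 < y → (∑ l, y ^ e l • T l).det = (y ^ D) ^ 2 * g D y := by
    intro y hy
    have h1 : ∑ l, y ^ e l • T l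
        = (εb * tb ^ D) • vecMulVec v' v' + y ^ D • P y
          + (y ^ (n₀ + 2 * D) * (εt * (ts ^ (n₀ + D))⁻¹)) • vecMulVec v v := by
      show ∑ l, y ^ (Fin.cons 0 (Fin.snoc (fun l => d l + D) ((∑ i, d i) + 1 + 2 * D) : Fin (K + 1) → ℕ) :
          Fin (K + 1 + 1) → ℕ) l • (Fin.cons ((εb * tb ^ D) • vecMulVec v' v')
          (Fin.snoc S ((εt * (ts ^ (n₀ + D))⁻¹) • vecMulVec v v) : Fin (K + 1) → Matrix (Fin 2) (Fin 2) ℝ) :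
          Fin (K + 1 + 1) → Matrix (Fin 2) (Fin 2) ℝ) l = _
      rw [cons_snoc_eval, hP, smul_smul]
    rw [h1, hdet D y hy]
  -- carriers
  set s : Fin (Mb + N + Mt + 3) → ℝ := fun j =>
    if h : (j : ℕ) ≤ Mb then εb * u' (ρ ⟨j, Nat.lt_succ_of_le h⟩)
    else if h' : (j : ℕ) ≤ Mb + N + 1 then (P (τ ⟨(j : ℕ) - (Mb + 1), by omega⟩)).det
    else εt * u (σ ⟨(j : ℕ) - (Mb + N + 2), by omega⟩) with hs
  have hτ'1 : ∀ (j : Fin (Mb + N + Mt + 3)) (h : (j : ℕ) ≤ Mb), τ' j = ρ ⟨j, Nat.lt_succ_of_le h⟩ :=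
    fun j h => by simp only [τ', dif_pos h]
  have hτ'2 : ∀ (j : Fin (Mb + N + Mt + 3)) (h : ¬ (j : ℕ) ≤ Mb) (h' : (j : ℕ) ≤ Mb + N + 1),
      τ' j = τ ⟨(j : ℕ) - (Mb + 1), by omega⟩ := fun j h h' => by simp only [τ', dif_neg h, dif_pos h']
  have hτ'3 : ∀ (j : Fin (Mb + N + Mt + 3)) (h : ¬ (j : ℕ) ≤ Mb) (h' : ¬ (j : ℕ) ≤ Mb + N + 1),
      τ' j = σ ⟨(j : ℕ) - (Mb + N + 2), by omega⟩ := fun j h h' => by simp only [τ', dif_neg h, dif_neg h']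
  have hs1 : ∀ (j : Fin (Mb + N + Mt + 3)) (h : (j : ℕ) ≤ Mb), s j = εb * u' (ρ ⟨j, Nat.lt_succ_of_le h⟩) :=
    fun j h => by simp only [hs, dif_pos h]
  have hs2 : ∀ (j : Fin (Mb + N + Mt + 3)) (h : ¬ (j : ℕ) ≤ Mb) (h' : (j : ℕ) ≤ Mb + N + 1),
      s j = (P (τ ⟨(j : ℕ) - (Mb + 1), by omega⟩)).det := fun j h h' => by simp only [hs, dif_neg h, dif_pos h']
  have hs3 : ∀ (j : Fin (Mb + N + Mt + 3)) (h : ¬ (j : ℕ) ≤ Mb) (h' : ¬ (j : ℕ) ≤ Mb + N + 1),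
      s j = εt * u (σ ⟨(j : ℕ) - (Mb + N + 2), by omega⟩) := fun j h h' => by simp only [hs, dif_neg h, dif_neg h']
  have hpos' : ∀ j, 0 < τ' j := by
    intro j
    by_cases h : (j : ℕ) ≤ Mb
    · rw [hτ'1 j h]; exact hρpos _
    · by_cases h' : (j : ℕ) ≤ Mb + N + 1
      · rw [hτ'2 j h h']; exact hτpos _
      · rw [hτ'3 j h h']; exact hσpos _
  -- (F1) carriers carry the signs
  have hF1 : ∀ j : Fin (Mb + N + Mt + 3), 0 < (∑ l, τ' j ^ e l • T l).det * s j := by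
    intro j
    rw [heval _ (hpos' j)]
    have hq : 0 < (τ' j ^ D) ^ 2 := pow_pos (pow_pos (hpos' j) _) _
    by_cases h : (j : ℕ) ≤ Mb
    · rw [hτ'1 j h, hs1 j h] at *
      have := hDbot ⟨j, Nat.lt_succ_of_le h⟩
      rw [mul_assoc]; exact mul_pos hq this
    · by_cases h' : (j : ℕ) ≤ Mb + N + 1
      · rw [hτ'2 j h h', hs2 j h h'] at *
        have := hDcore ⟨(j : ℕ) - (Mb + 1), by omega⟩
        rw [mul_assoc]; exact mul_pos hq this
      · rw [hτ'3 j h h', hs3 j h h'] at *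
        have := hDtop ⟨(j : ℕ) - (Mb + N + 2), by omega⟩
        rw [mul_assoc]; exact mul_pos hq this
  -- (F2) consecutive carriers have opposite signs
  have hF2 : ∀ j : Fin (Mb + N + Mt + 2), s j.castSucc * s j.succ < 0 := by
    intro j
    have hc : ((Fin.castSucc j : Fin (Mb + N + Mt + 3)) : ℕ) = j := rfl
    have hsu : ((Fin.succ j : Fin (Mb + N + Mt + 3)) : ℕ) = j + 1 := rfl
    have hεb2 : 0 < εb * εb := mul_self_pos.mpr hεbne
    have hεt2 : 0 < εt * εt := mul_self_pos.mpr hεtne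
    by_cases h1 : (j : ℕ) + 1 ≤ Mb
    · -- inside the bottom block
      rw [hs1 _ (by rw [hc]; omega), hs1 _ (by rw [hsu]; exact h1)]
      have hidx : (⟨(Fin.succ j : ℕ), Nat.lt_succ_of_le (by rw [hsu]; exact h1)⟩ : Fin (Mb + 1))
          = Fin.succ ⟨(j : ℕ), by omega⟩ := Fin.ext (by simp)
      have hidx' : (⟨(Fin.castSucc j : ℕ), Nat.lt_succ_of_le (by rw [hc]; omega)⟩ : Fin (Mb + 1))
          = Fin.castSucc ⟨(j : ℕ), by omega⟩ := Fin.ext (by simp)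
      rw [hidx, hidx']
      have h := hualt' ⟨(j : ℕ), by omega⟩
      have hrw : εb * u' (ρ (Fin.castSucc ⟨(j : ℕ), by omega⟩)) * (εb * u' (ρ (Fin.succ ⟨(j : ℕ), by omega⟩)))
          = (εb * εb) * (u' (ρ (Fin.castSucc ⟨(j : ℕ), by omega⟩)) * u' (ρ (Fin.succ ⟨(j : ℕ), by omega⟩))) := by ring
      rw [hrw]
      exact mul_neg_of_pos_of_neg hεb2 h
    · by_cases h2 : (j : ℕ) ≤ Mb
      · -- bottom junction: j = Mb
        have hjM : (j : ℕ) = Mb := by omega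
        rw [hs1 _ (by rw [hc]; exact h2), hs2 _ (by rw [hsu]; omega) (by rw [hsu]; omega)]
        have hlast : (⟨(Fin.castSucc j : ℕ), Nat.lt_succ_of_le (by rw [hc]; exact h2)⟩ : Fin (Mb + 1)) = Fin.last Mb :=
          Fin.ext (by simp [hjM])
        have hzero : (⟨(Fin.succ j : ℕ) - (Mb + 1), by rw [hsu]; omega⟩ : Fin (N + 1)) = 0 :=
          Fin.ext (by simp [hjM])
        rw [hlast, hzero, hεb]
        have hsq : 0 < ((P (τ 0)).det * u' (ρ (Fin.last Mb))) ^ 2 := by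
          have : (P (τ 0)).det * u' (ρ (Fin.last Mb)) ≠ 0 := mul_ne_zero (hne 0) (hune' _)
          positivity
        nlinarith [hsq]
      · by_cases h3 : (j : ℕ) + 1 ≤ Mb + N + 1
        · -- inside the core block
          rw [hs2 _ (by rw [hc]; omega) (by rw [hc]; omega), hs2 _ (by rw [hsu]; omega) (by rw [hsu]; exact h3)]
          have h := halt ⟨(j : ℕ) - (Mb + 1), by omega⟩
          have hidx : (⟨(Fin.succ j : ℕ) - (Mb + 1), by rw [hsu]; omega⟩ : Fin (N + 1))
              = Fin.succ ⟨(j : ℕ) - (Mb + 1), by omega⟩ := Fin.ext (by simp; omega)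
          have hidx' : (⟨(Fin.castSucc j : ℕ) - (Mb + 1), by rw [hc]; omega⟩ : Fin (N + 1))
              = Fin.castSucc ⟨(j : ℕ) - (Mb + 1), by omega⟩ := Fin.ext (by simp)
          rw [hidx, hidx']
          simpa [hP] using h
        · by_cases h4 : (j : ℕ) ≤ Mb + N + 1
          · -- top junction: j = Mb + N + 1
            have hjT : (j : ℕ) = Mb + N + 1 := by omega
            rw [hs2 _ (by rw [hc]; omega) (by rw [hc]; exact h4), hs3 _ (by rw [hsu]; omega) (by rw [hsu]; omega)]
            have hlast : (⟨(Fin.castSucc j : ℕ) - (Mb + 1), by rw [hc]; omega⟩ : Fin (N + 1)) = Fin.last N :=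
              Fin.ext (by simp [hjT])
            have hzero : (⟨(Fin.succ j : ℕ) - (Mb + N + 2), by rw [hsu]; omega⟩ : Fin (Mt + 1)) = 0 :=
              Fin.ext (by simp [hjT])
            rw [hlast, hzero, hεt]
            have hsq : 0 < ((P (τ (Fin.last N))).det * u (σ 0)) ^ 2 := by
              have : (P (τ (Fin.last N))).det * u (σ 0) ≠ 0 := mul_ne_zero (hne _) (hune 0)
              positivity
            nlinarith [hsq]
          · -- inside the top block
            rw [hs3 _ (by rw [hc]; omega) (by rw [hc]; exact h4), hs3 _ (by rw [hsu]; omega) (by rw [hsu]; omega)]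
            have hidx : (⟨(Fin.succ j : ℕ) - (Mb + N + 2), by rw [hsu]; omega⟩ : Fin (Mt + 1))
                = Fin.succ ⟨(j : ℕ) - (Mb + N + 2), by omega⟩ := Fin.ext (by simp; omega)
            have hidx' : (⟨(Fin.castSucc j : ℕ) - (Mb + N + 2), by rw [hc]; omega⟩ : Fin (Mt + 1))
                = Fin.castSucc ⟨(j : ℕ) - (Mb + N + 2), by omega⟩ := Fin.ext (by simp)
            rw [hidx, hidx']
            have h := hualt ⟨(j : ℕ) - (Mb + N + 2), by omega⟩
            have hrw : εt * u (σ (Fin.castSucc ⟨(j : ℕ) - (Mb + N + 2), by omega⟩)) *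
                (εt * u (σ (Fin.succ ⟨(j : ℕ) - (Mb + N + 2), by omega⟩)))
                = (εt * εt) * (u (σ (Fin.castSucc ⟨(j : ℕ) - (Mb + N + 2), by omega⟩)) *
                  u (σ (Fin.succ ⟨(j : ℕ) - (Mb + N + 2), by omega⟩))) := by ring
            rw [hrw]
            exact mul_neg_of_pos_of_neg hεt2 h
  refine ⟨strictMono_glue3 ρ τ σ hρ hτ hσ hsep' hsep, hpos', ?_, ?_⟩
  · intro j h0
    have := hF1 j
    rw [h0, zero_mul] at this
    exact lt_irrefl _ this
  · intro j
    exact mul_neg_of_carriers (hF1 j.castSucc) (hF1 j.succ) (hF2 j)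

/-- **Row form: two deep ends at `m = 2` are worth `(2 + M_t) + (2 + M_b)`.**  Under the hypotheses of `exists_alternating_twoDeepEnds` with
symmetric letters on a strictly increasing support, `¬ PosRootLawAt 2 (K+2) (N + M_t + M_b + 3)` (the two rank-one end letters each add one
more alternation by the tree's two-ended TAIL GRAFT). [folklore] -/
theorem not_posRootLawAt_twoDeepEnds {K N Mt Mb : ℕ} (d : Fin K → ℕ) (hd : StrictMono d)
    (S : Fin K → Matrix (Fin 2) (Fin 2) ℝ) (hS : ∀ l, (S l).IsSymm)
    (τ : Fin (N + 1) → ℝ) (hτ : StrictMono τ) (hτpos : ∀ j, 0 < τ j)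
    (hne : ∀ j, (∑ l, τ j ^ d l • S l).det ≠ 0)
    (halt : ∀ j : Fin N, (∑ l, τ j.castSucc ^ d l • S l).det * (∑ l, τ j.succ ^ d l • S l).det < 0)
    (v : Fin 2 → ℝ) (σ : Fin (Mt + 1) → ℝ) (hσ : StrictMono σ) (hsep : τ (Fin.last N) < σ 0)
    (hune : ∀ j, v ⬝ᵥ ((∑ l, σ j ^ d l • S l).adjugate *ᵥ v) ≠ 0)
    (hualt : ∀ j : Fin Mt, (v ⬝ᵥ ((∑ l, σ j.castSucc ^ d l • S l).adjugate *ᵥ v)) *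
      (v ⬝ᵥ ((∑ l, σ j.succ ^ d l • S l).adjugate *ᵥ v)) < 0)
    (v' : Fin 2 → ℝ) (ρ : Fin (Mb + 1) → ℝ) (hρ : StrictMono ρ) (hρpos : ∀ j, 0 < ρ j) (hsep' : ρ (Fin.last Mb) < τ 0)
    (hune' : ∀ j, v' ⬝ᵥ ((∑ l, ρ j ^ d l • S l).adjugate *ᵥ v') ≠ 0)
    (hualt' : ∀ j : Fin Mb, (v' ⬝ᵥ ((∑ l, ρ j.castSucc ^ d l • S l).adjugate *ᵥ v')) *
      (v' ⬝ᵥ ((∑ l, ρ j.succ ^ d l • S l).adjugate *ᵥ v')) < 0) :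
    ¬ PosRootLawAt 2 (K + 1 + 1) (N + Mt + Mb + 3) := by
  classical
  obtain ⟨D, μb, μt, hD0, hDn, hμb, hμt, hmono, hpos, hne', halt'⟩ :=
    exists_alternating_twoDeepEnds d S τ hτ hτpos hne halt v σ hσ hsep hune hualt v' ρ hρ hρpos hsep' hune' hualt'
  have hv : v ≠ 0 := by
    intro h0; apply hune 0; rw [h0, zero_dotProduct]
  have hv' : v' ≠ 0 := by
    intro h0; apply hune' 0; rw [h0, zero_dotProduct]
  -- the support is strictly increasing
  have he := strictMono_cons_snoc hd hD0 (E := (∑ i, d i) + 1 + 2 * D) (by omega) (fun l => by have := hDn l; omega)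
  -- symmetric letters, rank-one ends
  have hT := isSymm_cons_snoc hS (μb • vecMulVec v' v') (μt • vecMulVec v v)
    ((isSymm_vecMulVec_self v').smul μb) ((isSymm_vecMulVec_self v).smul μt)
  have h0 : (Fin.cons (μb • vecMulVec v' v') (Fin.snoc S (μt • vecMulVec v v) : Fin (K + 1) → Matrix (Fin 2) (Fin 2) ℝ) :
      Fin (K + 1 + 1) → Matrix (Fin 2) (Fin 2) ℝ) 0 = μb • vecMulVec v' v' := by simp only [Fin.cons_zero]
  have hl : (Fin.cons (μb • vecMulVec v' v') (Fin.snoc S (μt • vecMulVec v v) : Fin (K + 1) → Matrix (Fin 2) (Fin 2) ℝ) :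
      Fin (K + 1 + 1) → Matrix (Fin 2) (Fin 2) ℝ) (Fin.last (K + 1)) = μt • vecMulVec v v := by
    rw [← Fin.succ_last, Fin.cons_succ, Fin.snoc_last]
  have h := not_posRootLawAt_of_tail_both (K := K + 1) (N := Mb + N + Mt + 2) (by omega) _ _ he hT
    (by rw [h0]; exact det_smul_vecMulVec_two μb v') (by rw [h0]; exact smul_vecMulVec_ne_zero hμb hv')
    (by rw [hl]; exact det_smul_vecMulVec_two μt v) (by rw [hl]; exact smul_vecMulVec_ne_zero hμt hv)
    _ hmono hpos hne' halt'
  have e : Mb + N + Mt + 2 + 1 = N + Mt + Mb + 3 := by omega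
  rw [e] at h
  exact h

end Summit.ValiantsHypothesis.ValiantsHypothesis.Theorems.LacunarySymmetroidMatrixDescartes.Census.DeepEnd
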